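import Summits.Ventures.HodgeRepro2.T5BergmanActStable

/-!
# The matrix coefficients `g ↦ ⟨π_k(g) f, h⟩_k` of the weighted Bergman model: continuity and the
`K`-equivariance

For `f, h` in the weight-`k` Bergman space `A_k` (`k ≥ 2`) the matrix coefficient
`matrixCoeff k f h : SU(1,1) → ℂ`, `g ↦ ⟨π_k(g) f, h⟩_k`, generalises the lowest-weight coefficient
`T5BergmanSchur.coeffLowest k h = matrixCoeff k lowest h`. This file proves

* sesquilinearity in `(f, h)` (`matrixCoeff_add_left`, `matrixCoeff_sub_left`, `matrixCoeff_sum`,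
  `matrixCoeff_partialSum`, `matrixCoeff_sub_right`, …) and the Cauchy–Schwarz bound
  `|⟨π_k(g) f, h⟩_k| ≤ √(⟨f,f⟩_k ⟨h,h⟩_k)` (`norm_matrixCoeff_le`);
* **the matrix coefficients are continuous on `SU(1,1)`** (`continuous_matrixCoeff`): for bounded `f, h`
  by dominated convergence (`continuous_matrixCoeff_of_bounded`), then for a polynomial against any
  `h ∈ A_k` and finally for arbitrary `f, h ∈ A_k` by UNIFORM approximation through the Taylor
  polynomials (`norm_matrixCoeff_sub_partialSum_left_le`, `norm_matrixCoeff_sub_partialSum_right_le`: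
  `sup_g |⟨π_k(g)(f - S_N f), h⟩_k| ≤ √(‖f - S_N f‖² ‖h‖²) → 0`);
* **the right `K`-equivariance of the monomial coefficients**:
  `⟨π_k(g · rot u) zᵐ, h⟩_k = u^{-(k+2m)} ⟨π_k(g) zᵐ, h⟩_k` (`matrixCoeff_monomial_mul_rot`).

Blind lane: Mathlib + the HodgeRepro2 prefix only; no sorry; axioms ⊆ {propext, Classical.choice,
Quot.sound}.
-/

namespace Summit.Ventures.HodgeRepro2.T5BergmanMatrixCoeff

open MeasureTheory MeasureTheory.Measure Metric Filter Topology
open T5PoincareDensity T5SU11Unimodular T5SU11Fibration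
open T5BergmanCoefficient T5BergmanPairing T5BergmanUnitary T5BergmanFourier T5BergmanKernel
  T5BergmanParseval T5BergmanPointwise T5BergmanProjection T5BergmanCoefficientL2 T5BergmanActStable
open scoped Real

/-! ### The coefficient and its sesquilinearity -/

/-- The matrix coefficient `g ↦ ⟨π_k(g) f, h⟩_k`. -/
noncomputable def matrixCoeff (k : ℕ) (f h : ℂ → ℂ) (g : SU11) : ℂ := pairing k (act k g f) h

/-- The lowest-weight coefficient of `T5BergmanSchur` is the case `f = 1`. -/
theorem matrixCoeff_lowest (k : ℕ) (h : ℂ → ℂ) :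
    matrixCoeff k lowest h = T5BergmanSchur.coeffLowest k h := rfl

/-- The representation property: `⟨π_k(g g') f, h⟩_k = ⟨π_k(g) (π_k(g') f), h⟩_k`. -/
theorem matrixCoeff_mul (k : ℕ) (f h : ℂ → ℂ) (g g' : SU11) :
    matrixCoeff k f h (g * g') = matrixCoeff k (act k g' f) h g :=
  pairing_act_mul k g g' f h

/-- `⟨π_k(g)(c f), h⟩_k = c ⟨π_k(g) f, h⟩_k`. -/
theorem matrixCoeff_const_mul_left (k : ℕ) (c : ℂ) (f h : ℂ → ℂ) (g : SU11) :
    matrixCoeff k (fun w => c * f w) h g = c * matrixCoeff k f h g := by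
  unfold matrixCoeff
  rw [pairing_congr (fun z _ => act_const_mul k g c f z) (fun _ _ => rfl)]
  exact pairing_smul_left k c _ h

/-- `⟨π_k(g) f, c h⟩_k = c̄ ⟨π_k(g) f, h⟩_k`. -/
theorem matrixCoeff_const_mul_right (k : ℕ) (c : ℂ) (f h : ℂ → ℂ) (g : SU11) :
    matrixCoeff k f (fun w => c * h w) g = (starRingEnd ℂ) c * matrixCoeff k f h g :=
  pairing_smul_right k c _ h

/-- Two functions agreeing on the disc have the same matrix coefficients. -/
theorem matrixCoeff_congr {k : ℕ} {f f' h h' : ℂ → ℂ} (hf : ∀ z ∈ ball (0 : ℂ) 1, f z = f' z)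
    (hh : ∀ z ∈ ball (0 : ℂ) 1, h z = h' z) (g : SU11) :
    matrixCoeff k f h g = matrixCoeff k f' h' g := by
  unfold matrixCoeff
  refine pairing_congr (fun z hz => ?_) hh
  unfold act
  rw [hf _ (mobius_mem_ball g⁻¹ hz)]

/-- Additivity in `f` for holomorphic `f₁, f₂ ∈ A_k`. -/
theorem matrixCoeff_add_left (k : ℕ) (hk : 2 ≤ k) (f₁ f₂ h : ℂ → ℂ)
    (hf₁ : DifferentiableOn ℂ f₁ (ball 0 1))
    (hf₁int : IntegrableOn (fun w => ‖f₁ w‖ ^ 2 * (1 - ‖w‖ ^ 2) ^ (k - 2)) (ball (0 : ℂ) 1))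
    (hf₂ : DifferentiableOn ℂ f₂ (ball 0 1))
    (hf₂int : IntegrableOn (fun w => ‖f₂ w‖ ^ 2 * (1 - ‖w‖ ^ 2) ^ (k - 2)) (ball (0 : ℂ) 1))
    (hh : ContinuousOn h (ball 0 1))
    (hhint : IntegrableOn (fun w => ‖h w‖ ^ 2 * (1 - ‖w‖ ^ 2) ^ (k - 2)) (ball (0 : ℂ) 1)) (g : SU11) :
    matrixCoeff k (f₁ + f₂) h g = matrixCoeff k f₁ h g + matrixCoeff k f₂ h g := by
  unfold matrixCoeff
  rw [pairing_congr (fun z _ => act_add k g f₁ f₂ z) (fun _ _ => rfl)]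
  exact pairing_add_left k (integrableOn_act_mul_conj k hk g f₁ h hf₁ hf₁int hh hhint)
    (integrableOn_act_mul_conj k hk g f₂ h hf₂ hf₂int hh hhint)

/-- Subtractivity in `f` for holomorphic `f₁, f₂ ∈ A_k`. -/
theorem matrixCoeff_sub_left (k : ℕ) (hk : 2 ≤ k) (f₁ f₂ h : ℂ → ℂ)
    (hf₁ : DifferentiableOn ℂ f₁ (ball 0 1))
    (hf₁int : IntegrableOn (fun w => ‖f₁ w‖ ^ 2 * (1 - ‖w‖ ^ 2) ^ (k - 2)) (ball (0 : ℂ) 1))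
    (hf₂ : DifferentiableOn ℂ f₂ (ball 0 1))
    (hf₂int : IntegrableOn (fun w => ‖f₂ w‖ ^ 2 * (1 - ‖w‖ ^ 2) ^ (k - 2)) (ball (0 : ℂ) 1))
    (hh : ContinuousOn h (ball 0 1))
    (hhint : IntegrableOn (fun w => ‖h w‖ ^ 2 * (1 - ‖w‖ ^ 2) ^ (k - 2)) (ball (0 : ℂ) 1)) (g : SU11) :
    matrixCoeff k (f₁ - f₂) h g = matrixCoeff k f₁ h g - matrixCoeff k f₂ h g := by
  have e : f₁ - f₂ = f₁ + fun w => (-1 : ℂ) * f₂ w := by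
    funext w
    simp only [Pi.sub_apply, Pi.add_apply]
    ring
  have hneg : DifferentiableOn ℂ (fun w => (-1 : ℂ) * f₂ w) (ball 0 1) :=
    (differentiableOn_const _).mul hf₂
  have hnegint : IntegrableOn (fun w => ‖(-1 : ℂ) * f₂ w‖ ^ 2 * (1 - ‖w‖ ^ 2) ^ (k - 2))
      (ball (0 : ℂ) 1) := by
    refine hf₂int.congr_fun (fun w _ => ?_) measurableSet_ball
    simp
  rw [e, matrixCoeff_add_left k hk f₁ _ h hf₁ hf₁int hneg hnegint hh hhint,
    matrixCoeff_const_mul_left]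
  ring

/-- Additivity in `h` for `h₁, h₂ ∈ A_k` (continuous on `𝔻`) and holomorphic `f ∈ A_k`. -/
theorem matrixCoeff_add_right (k : ℕ) (hk : 2 ≤ k) (f h₁ h₂ : ℂ → ℂ)
    (hf : DifferentiableOn ℂ f (ball 0 1))
    (hfint : IntegrableOn (fun w => ‖f w‖ ^ 2 * (1 - ‖w‖ ^ 2) ^ (k - 2)) (ball (0 : ℂ) 1))
    (hh₁ : ContinuousOn h₁ (ball 0 1))
    (hh₁int : IntegrableOn (fun w => ‖h₁ w‖ ^ 2 * (1 - ‖w‖ ^ 2) ^ (k - 2)) (ball (0 : ℂ) 1))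
    (hh₂ : ContinuousOn h₂ (ball 0 1))
    (hh₂int : IntegrableOn (fun w => ‖h₂ w‖ ^ 2 * (1 - ‖w‖ ^ 2) ^ (k - 2)) (ball (0 : ℂ) 1))
    (g : SU11) :
    matrixCoeff k f (h₁ + h₂) g = matrixCoeff k f h₁ g + matrixCoeff k f h₂ g :=
  pairing_add_right k (integrableOn_act_mul_conj k hk g f h₁ hf hfint hh₁ hh₁int)
    (integrableOn_act_mul_conj k hk g f h₂ hf hfint hh₂ hh₂int)

/-- Subtractivity in `h`. -/
theorem matrixCoeff_sub_right (k : ℕ) (hk : 2 ≤ k) (f h₁ h₂ : ℂ → ℂ)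
    (hf : DifferentiableOn ℂ f (ball 0 1))
    (hfint : IntegrableOn (fun w => ‖f w‖ ^ 2 * (1 - ‖w‖ ^ 2) ^ (k - 2)) (ball (0 : ℂ) 1))
    (hh₁ : ContinuousOn h₁ (ball 0 1))
    (hh₁int : IntegrableOn (fun w => ‖h₁ w‖ ^ 2 * (1 - ‖w‖ ^ 2) ^ (k - 2)) (ball (0 : ℂ) 1))
    (hh₂ : ContinuousOn h₂ (ball 0 1))
    (hh₂int : IntegrableOn (fun w => ‖h₂ w‖ ^ 2 * (1 - ‖w‖ ^ 2) ^ (k - 2)) (ball (0 : ℂ) 1))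
    (g : SU11) :
    matrixCoeff k f (h₁ - h₂) g = matrixCoeff k f h₁ g - matrixCoeff k f h₂ g := by
  have e : h₁ - h₂ = h₁ + fun w => (-1 : ℂ) * h₂ w := by
    funext w
    simp only [Pi.sub_apply, Pi.add_apply]
    ring
  have hneg : ContinuousOn (fun w => (-1 : ℂ) * h₂ w) (ball 0 1) := continuousOn_const.mul hh₂
  have hnegint : IntegrableOn (fun w => ‖(-1 : ℂ) * h₂ w‖ ^ 2 * (1 - ‖w‖ ^ 2) ^ (k - 2))
      (ball (0 : ℂ) 1) := by
    refine hh₂int.congr_fun (fun w _ => ?_) measurableSet_ball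
    simp
  rw [e, matrixCoeff_add_right k hk f h₁ _ hf hfint hh₁ hh₁int hneg hnegint,
    matrixCoeff_const_mul_right]
  simp only [map_neg, map_one]
  ring

/-- **Linearity on finite sums**: `⟨π_k(g) Σ c_i F_i, h⟩_k = Σ c_i ⟨π_k(g) F_i, h⟩_k`. -/
theorem matrixCoeff_sum (k : ℕ) (hk : 2 ≤ k) {ι : Type*} (s : Finset ι) (c : ι → ℂ)
    (F : ι → ℂ → ℂ) (hF : ∀ i ∈ s, DifferentiableOn ℂ (F i) (ball 0 1))
    (hFint : ∀ i ∈ s, IntegrableOn (fun w => ‖F i w‖ ^ 2 * (1 - ‖w‖ ^ 2) ^ (k - 2)) (ball (0 : ℂ) 1))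
    (h : ℂ → ℂ) (hh : ContinuousOn h (ball 0 1))
    (hhint : IntegrableOn (fun w => ‖h w‖ ^ 2 * (1 - ‖w‖ ^ 2) ^ (k - 2)) (ball (0 : ℂ) 1)) (g : SU11) :
    matrixCoeff k (fun w => ∑ i ∈ s, c i * F i w) h g = ∑ i ∈ s, c i * matrixCoeff k (F i) h g := by
  unfold matrixCoeff pairing
  have e : ∀ z, act k g (fun w => ∑ i ∈ s, c i * F i w) z * (starRingEnd ℂ) (h z) *
      (((1 - ‖z‖ ^ 2) ^ (k - 2) : ℝ) : ℂ) =
      ∑ i ∈ s, c i * (act k g (F i) z * (starRingEnd ℂ) (h z) * (((1 - ‖z‖ ^ 2) ^ (k - 2) : ℝ) : ℂ)) := by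
    intro z
    have h1 := act_sum k g s (fun i w => c i * F i w) z
    rw [h1]
    simp_rw [act_const_mul]
    rw [Finset.sum_mul, Finset.sum_mul]
    exact Finset.sum_congr rfl fun i _ => by ring
  simp_rw [e]
  rw [integral_finsetSum]
  · exact Finset.sum_congr rfl fun i _ => integral_const_mul _ _
  · intro i hi
    exact (integrableOn_act_mul_conj k hk g (F i) h (hF i hi) (hFint i hi) hh hhint).const_mul _

/-- The monomials are holomorphic. -/
lemma differentiableOn_monomial (m : ℕ) : DifferentiableOn ℂ (fun w : ℂ => w ^ m) (ball 0 1) :=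
  (differentiable_id.pow m).differentiableOn

/-- **The coefficient of a Taylor polynomial**: `⟨π_k(g) S_N, h⟩_k = Σ_{m<N} a_m ⟨π_k(g) zᵐ, h⟩_k`. -/
theorem matrixCoeff_partialSum (k : ℕ) (hk : 2 ≤ k) (a : ℕ → ℂ) (N : ℕ) (h : ℂ → ℂ)
    (hh : ContinuousOn h (ball 0 1))
    (hhint : IntegrableOn (fun w => ‖h w‖ ^ 2 * (1 - ‖w‖ ^ 2) ^ (k - 2)) (ball (0 : ℂ) 1)) (g : SU11) :
    matrixCoeff k (partialSum a N) h g =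
      ∑ m ∈ Finset.range N, a m * matrixCoeff k (fun w => w ^ m) h g :=
  matrixCoeff_sum k hk (Finset.range N) a (fun m w => w ^ m) (fun m _ => differentiableOn_monomial m)
    (fun m _ => integrableOn_monomial k m) h hh hhint g

/-- **Cauchy–Schwarz**: `|⟨π_k(g) f, h⟩_k| ≤ √(⟨f, f⟩_k ⟨h, h⟩_k)`. -/
theorem norm_matrixCoeff_le (k : ℕ) (hk : 2 ≤ k) (f h : ℂ → ℂ)
    (hf : DifferentiableOn ℂ f (ball 0 1))
    (hfint : IntegrableOn (fun w => ‖f w‖ ^ 2 * (1 - ‖w‖ ^ 2) ^ (k - 2)) (ball (0 : ℂ) 1))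
    (hh : ContinuousOn h (ball 0 1))
    (hhint : IntegrableOn (fun w => ‖h w‖ ^ 2 * (1 - ‖w‖ ^ 2) ^ (k - 2)) (ball (0 : ℂ) 1)) (g : SU11) :
    ‖matrixCoeff k f h g‖ ≤ Real.sqrt ((pairing k f f).re * (pairing k h h).re) :=
  norm_pairing_act_le k hk g f h hf hfint hh hhint

/-! ### The `K`-equivariance of the monomial coefficients -/

/-- **Right `K`-equivariance**: `⟨π_k(g · rot u) zᵐ, h⟩_k = u^{-(k+2m)} ⟨π_k(g) zᵐ, h⟩_k`. -/
theorem matrixCoeff_monomial_mul_rot (k m : ℕ) (h : ℂ → ℂ) (g : SU11) (u : Circle) :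
    matrixCoeff k (fun w => w ^ m) h (g * rot u) =
      ((u : ℂ)⁻¹) ^ (k + 2 * m) * matrixCoeff k (fun w => w ^ m) h g := by
  rw [matrixCoeff_mul, ← matrixCoeff_const_mul_left]
  exact matrixCoeff_congr (fun z _ => act_rot_monomial k m u z) (fun _ _ => rfl) g

/-- The coefficient of a Taylor polynomial at `g · rot u`. -/
theorem matrixCoeff_partialSum_mul_rot (k : ℕ) (hk : 2 ≤ k) (a : ℕ → ℂ) (N : ℕ) (h : ℂ → ℂ)
    (hh : ContinuousOn h (ball 0 1))
    (hhint : IntegrableOn (fun w => ‖h w‖ ^ 2 * (1 - ‖w‖ ^ 2) ^ (k - 2)) (ball (0 : ℂ) 1))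
    (g : SU11) (u : Circle) :
    matrixCoeff k (partialSum a N) h (g * rot u) =
      ∑ m ∈ Finset.range N, a m * (((u : ℂ)⁻¹) ^ (k + 2 * m) * matrixCoeff k (fun w => w ^ m) h g) := by
  rw [matrixCoeff_partialSum k hk a N h hh hhint]
  exact Finset.sum_congr rfl fun m _ => by rw [matrixCoeff_monomial_mul_rot]

/-! ### Continuity on the group -/

/-- The weight `(1 - |z|²)^{k-2}` is integrable on the disc. -/
lemma integrableOn_weight (k : ℕ) :
    IntegrableOn (fun z : ℂ => (1 - ‖z‖ ^ 2) ^ (k - 2)) (ball (0 : ℂ) 1) := by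
  have := integrableOn_monomial k 0
  simpa using this

/-- **Continuity for bounded `f, h`** (dominated convergence): `g ↦ ⟨π_k(g) f, h⟩_k` is continuous
on `SU(1,1)` when `f, h` are continuous and bounded on the disc. -/
theorem continuous_matrixCoeff_of_bounded (k : ℕ) (f h : ℂ → ℂ) (hf : ContinuousOn f (ball 0 1))
    (hh : ContinuousOn h (ball 0 1)) {Mf Mh : ℝ} (hMf : ∀ w ∈ ball (0 : ℂ) 1, ‖f w‖ ≤ Mf)
    (hMh : ∀ w ∈ ball (0 : ℂ) 1, ‖h w‖ ≤ Mh) : Continuous (matrixCoeff k f h) := by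
  have hMf0 : 0 ≤ Mf := (norm_nonneg _).trans (hMf 0 (mem_ball_self one_pos))
  have hMh0 : 0 ≤ Mh := (norm_nonneg _).trans (hMh 0 (mem_ball_self one_pos))
  rw [continuous_iff_continuousAt]
  intro g₀
  unfold matrixCoeff pairing
  refine continuousAt_of_dominated
    (bound := fun w => (2 * (‖mat g₀ 0 0‖ + 1)) ^ k * Mf * Mh * (1 - ‖w‖ ^ 2) ^ (k - 2)) ?_ ?_ ?_ ?_
  · refine Eventually.of_forall fun g => ?_
    exact (((continuousOn_act k g f hf).mul (Complex.continuous_conj.comp_continuousOn hh)).mul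
      (by fun_prop : Continuous fun z : ℂ => (((1 - ‖z‖ ^ 2) ^ (k - 2) : ℝ) : ℂ)).continuousOn).aestronglyMeasurable
      measurableSet_ball
  · have hev : ∀ᶠ g in 𝓝 g₀, ‖mat g 0 0‖ ≤ ‖mat g₀ 0 0‖ + 1 := by
      have hc : Tendsto (fun g : SU11 => ‖mat g 0 0‖) (𝓝 g₀) (𝓝 ‖mat g₀ 0 0‖) :=
        continuous_mat00.norm.continuousAt
      exact hc.eventually (eventually_le_nhds (by linarith))
    filter_upwards [hev] with g hg
    rw [ae_restrict_iff' measurableSet_ball]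
    refine Eventually.of_forall fun w hw => ?_
    rw [norm_mul, norm_mul, Complex.norm_conj, Complex.norm_real, Real.norm_eq_abs,
      abs_of_nonneg (weight_nonneg k hw)]
    have h1 : ‖act k g f w‖ ≤ (2 * (‖mat g₀ 0 0‖ + 1)) ^ k * Mf :=
      (norm_act_le k g f hMf hw).trans
        (mul_le_mul_of_nonneg_right (pow_le_pow_left₀ (by positivity) (by linarith) k) hMf0)
    have h2 := hMh w hw
    have h3 := weight_nonneg k hw
    calc ‖act k g f w‖ * ‖h w‖ * (1 - ‖w‖ ^ 2) ^ (k - 2)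
        ≤ ((2 * (‖mat g₀ 0 0‖ + 1)) ^ k * Mf) * Mh * (1 - ‖w‖ ^ 2) ^ (k - 2) := by
          gcongr
      _ = _ := by ring
  · exact ((integrableOn_weight k).const_mul _)
  · rw [ae_restrict_iff' measurableSet_ball]
    refine Eventually.of_forall fun w hw => ?_
    exact (((continuous_act_left k f hf hw).mul continuous_const).mul continuous_const).continuousAt

/-- A polynomial is bounded on the disc by the sum of the moduli of its coefficients. -/
lemma norm_partialSum_le (a : ℕ → ℂ) (N : ℕ) {w : ℂ} (hw : w ∈ ball (0 : ℂ) 1) :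
    ‖partialSum a N w‖ ≤ ∑ n ∈ Finset.range N, ‖a n‖ := by
  refine (norm_sum_le _ _).trans (Finset.sum_le_sum fun n _ => ?_)
  rw [norm_mul, norm_pow]
  exact mul_le_of_le_one_right (norm_nonneg _)
    (pow_le_one₀ (norm_nonneg _) (mem_ball_zero_iff.mp hw).le)

/-- Polynomials are entire. -/
lemma differentiable_partialSum (a : ℕ → ℂ) (N : ℕ) : Differentiable ℂ (partialSum a N) := by
  unfold partialSum
  fun_prop

/-- **A uniform limit of continuous matrix coefficients is continuous**: if `sup_g |c g - F_N g| ≤ e_N`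
with `e_N → 0` and every `F_N` continuous, then `c` is continuous. -/
lemma continuous_of_uniform_approx {F : ℕ → SU11 → ℂ} {c : SU11 → ℂ} {e : ℕ → ℝ}
    (hF : ∀ N, Continuous (F N)) (he : Tendsto e atTop (𝓝 0))
    (hb : ∀ N g, ‖c g - F N g‖ ≤ e N) : Continuous c := by
  have hu : TendstoUniformly F c atTop := by
    rw [Metric.tendstoUniformly_iff]
    intro ε hε
    filter_upwards [(tendsto_order.1 he).2 ε hε] with N hN g
    rw [dist_eq_norm]
    exact (hb N g).trans_lt hN
  exact hu.continuous (Eventually.of_forall hF).frequently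

/-- **Uniform approximation in the second slot**: for a holomorphic `f ∈ A_k` and `h ∈ A_k` with Taylor
coefficients `b`, `|⟨π_k(g) f, h⟩_k - ⟨π_k(g) f, T_N⟩_k| ≤ √(⟨f,f⟩_k ⟨h - T_N, h - T_N⟩_k)` for every `g`. -/
theorem norm_matrixCoeff_sub_partialSum_right_le (k : ℕ) (hk : 2 ≤ k) (f : ℂ → ℂ)
    (hf : DifferentiableOn ℂ f (ball 0 1))
    (hfint : IntegrableOn (fun w => ‖f w‖ ^ 2 * (1 - ‖w‖ ^ 2) ^ (k - 2)) (ball (0 : ℂ) 1))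
    (b : ℕ → ℂ) (h : ℂ → ℂ) (hh : ∀ w ∈ ball (0 : ℂ) 1, HasSum (fun m => b m * w ^ m) (h w))
    (hhint : IntegrableOn (fun w => ‖h w‖ ^ 2 * (1 - ‖w‖ ^ 2) ^ (k - 2)) (ball (0 : ℂ) 1))
    (N : ℕ) (g : SU11) :
    ‖matrixCoeff k f h g - matrixCoeff k f (partialSum b N) g‖ ≤
      Real.sqrt ((pairing k f f).re * (pairing k (h - partialSum b N) (h - partialSum b N)).re) := by
  have hhc : ContinuousOn h (ball 0 1) := continuousOn_ball b h hh
  have hTc : ContinuousOn (partialSum b N) (ball 0 1) := (differentiable_partialSum b N).continuous.continuousOn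
  rw [← matrixCoeff_sub_right k hk f h (partialSum b N) hf hfint hhc hhint hTc
    (integrableOn_partialSum k b N)]
  exact norm_matrixCoeff_le k hk f _ hf hfint (hhc.sub hTc)
    (integrableOn_sub_partialSum k hk b h hh hhint N) g

/-- **Uniform approximation in the first slot**: for holomorphic `f ∈ A_k` with Taylor coefficients `a`
and `h ∈ A_k`, `|⟨π_k(g) f, h⟩_k - ⟨π_k(g) S_N, h⟩_k| ≤ √(⟨f - S_N, f - S_N⟩_k ⟨h,h⟩_k)` for every `g`. -/
theorem norm_matrixCoeff_sub_partialSum_left_le (k : ℕ) (hk : 2 ≤ k) (a : ℕ → ℂ) (f : ℂ → ℂ)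
    (hf : DifferentiableOn ℂ f (ball 0 1))
    (hfa : ∀ w ∈ ball (0 : ℂ) 1, HasSum (fun m => a m * w ^ m) (f w))
    (hfint : IntegrableOn (fun w => ‖f w‖ ^ 2 * (1 - ‖w‖ ^ 2) ^ (k - 2)) (ball (0 : ℂ) 1))
    (h : ℂ → ℂ) (hh : ContinuousOn h (ball 0 1))
    (hhint : IntegrableOn (fun w => ‖h w‖ ^ 2 * (1 - ‖w‖ ^ 2) ^ (k - 2)) (ball (0 : ℂ) 1))
    (N : ℕ) (g : SU11) :
    ‖matrixCoeff k f h g - matrixCoeff k (partialSum a N) h g‖ ≤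
      Real.sqrt ((pairing k (f - partialSum a N) (f - partialSum a N)).re * (pairing k h h).re) := by
  have hS : DifferentiableOn ℂ (partialSum a N) (ball 0 1) :=
    (differentiable_partialSum a N).differentiableOn
  rw [← matrixCoeff_sub_left k hk f (partialSum a N) h hf hfint hS (integrableOn_partialSum k a N)
    hh hhint]
  exact norm_matrixCoeff_le k hk _ h (hf.sub hS) (integrableOn_sub_partialSum k hk a f hfa hfint N)
    hh hhint g

/-- **Continuity for a polynomial against `h ∈ A_k`.** -/
theorem continuous_matrixCoeff_partialSum (k : ℕ) (hk : 2 ≤ k) (a : ℕ → ℂ) (N : ℕ) (b : ℕ → ℂ)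
    (h : ℂ → ℂ) (hh : ∀ w ∈ ball (0 : ℂ) 1, HasSum (fun m => b m * w ^ m) (h w))
    (hhint : IntegrableOn (fun w => ‖h w‖ ^ 2 * (1 - ‖w‖ ^ 2) ^ (k - 2)) (ball (0 : ℂ) 1)) :
    Continuous (matrixCoeff k (partialSum a N) h) := by
  have hS : DifferentiableOn ℂ (partialSum a N) (ball 0 1) :=
    (differentiable_partialSum a N).differentiableOn
  refine continuous_of_uniform_approx (F := fun M => matrixCoeff k (partialSum a N) (partialSum b M))
    (e := fun M => Real.sqrt ((pairing k (partialSum a N) (partialSum a N)).re *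
      (pairing k (h - partialSum b M) (h - partialSum b M)).re)) (fun M => ?_) ?_ (fun M g => ?_)
  · exact continuous_matrixCoeff_of_bounded k _ _ hS.continuousOn
      (differentiable_partialSum b M).continuous.continuousOn (fun w hw => norm_partialSum_le a N hw)
      (fun w hw => norm_partialSum_le b M hw)
  · have h1 := (tendsto_pairing_sub_partialSum k hk b h hh hhint).const_mul
      (pairing k (partialSum a N) (partialSum a N)).re
    rw [mul_zero] at h1
    have h2 := h1.sqrt
    rwa [Real.sqrt_zero] at h2
  · exact norm_matrixCoeff_sub_partialSum_right_le k hk _ hS (integrableOn_partialSum k a N) b h hh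
      hhint M g

/-- **The matrix coefficients are continuous on `SU(1,1)`** for holomorphic `f, h ∈ A_k`. -/
theorem continuous_matrixCoeff (k : ℕ) (hk : 2 ≤ k) (a : ℕ → ℂ) (f : ℂ → ℂ)
    (hf : DifferentiableOn ℂ f (ball 0 1))
    (hfa : ∀ w ∈ ball (0 : ℂ) 1, HasSum (fun m => a m * w ^ m) (f w))
    (hfint : IntegrableOn (fun w => ‖f w‖ ^ 2 * (1 - ‖w‖ ^ 2) ^ (k - 2)) (ball (0 : ℂ) 1))
    (b : ℕ → ℂ) (h : ℂ → ℂ) (hh : ∀ w ∈ ball (0 : ℂ) 1, HasSum (fun m => b m * w ^ m) (h w))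
    (hhint : IntegrableOn (fun w => ‖h w‖ ^ 2 * (1 - ‖w‖ ^ 2) ^ (k - 2)) (ball (0 : ℂ) 1)) :
    Continuous (matrixCoeff k f h) := by
  have hhc : ContinuousOn h (ball 0 1) := continuousOn_ball b h hh
  refine continuous_of_uniform_approx (F := fun N => matrixCoeff k (partialSum a N) h)
    (e := fun N => Real.sqrt ((pairing k (f - partialSum a N) (f - partialSum a N)).re *
      (pairing k h h).re)) (fun N => continuous_matrixCoeff_partialSum k hk a N b h hh hhint) ?_
    (fun N g => norm_matrixCoeff_sub_partialSum_left_le k hk a f hf hfa hfint h hhc hhint N g)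
  have h1 := (tendsto_pairing_sub_partialSum k hk a f hfa hfint).mul_const (pairing k h h).re
  rw [zero_mul] at h1
  have h2 := h1.sqrt
  rwa [Real.sqrt_zero] at h2

/-- The same for holomorphic `f, h ∈ A_k` without naming the Taylor coefficients. -/
theorem continuous_matrixCoeff_of_differentiableOn (k : ℕ) (hk : 2 ≤ k) (f : ℂ → ℂ)
    (hf : DifferentiableOn ℂ f (ball 0 1))
    (hfint : IntegrableOn (fun w => ‖f w‖ ^ 2 * (1 - ‖w‖ ^ 2) ^ (k - 2)) (ball (0 : ℂ) 1))
    (h : ℂ → ℂ) (hh : DifferentiableOn ℂ h (ball 0 1))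
    (hhint : IntegrableOn (fun w => ‖h w‖ ^ 2 * (1 - ‖w‖ ^ 2) ^ (k - 2)) (ball (0 : ℂ) 1)) :
    Continuous (matrixCoeff k f h) :=
  continuous_matrixCoeff k hk _ f hf (hasSum_taylor f hf) hfint _ h (hasSum_taylor h hh) hhint

/-- **The monomial coefficients are continuous** for `h ∈ A_k`. -/
theorem continuous_matrixCoeff_monomial (k : ℕ) (hk : 2 ≤ k) (m : ℕ) (b : ℕ → ℂ) (h : ℂ → ℂ)
    (hh : ∀ w ∈ ball (0 : ℂ) 1, HasSum (fun n => b n * w ^ n) (h w))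
    (hhint : IntegrableOn (fun w => ‖h w‖ ^ 2 * (1 - ‖w‖ ^ 2) ^ (k - 2)) (ball (0 : ℂ) 1)) :
    Continuous (matrixCoeff k (fun w => w ^ m) h) := by
  have e : (fun w : ℂ => w ^ m) = partialSum (fun n => if n = m then 1 else 0) (m + 1) := by
    funext w
    simp [partialSum, Finset.sum_ite_eq', Finset.mem_range]
  rw [e]
  exact continuous_matrixCoeff_partialSum k hk _ (m + 1) b h hh hhint

end Summit.Ventures.HodgeRepro2.T5BergmanMatrixCoeff
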